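import Literature.MathematicalPhysics.QuantumFieldTheory.CurvatureGaussianField
import HarnessLib

/-!
# Stub `stub_secondDifference` of line `Sketch` (crux `stmt-QuantumFields-8760`)

Route `EquipartitionCriticality` of `YangMills`, crux item `stmt-QuantumFields-8760`
(`Summit.QuantumFields.YangMills.Theses.EquipartitionCriticality.EquipartitionPinsProbe`), line
`Sketch`, STUB 3 of the lead's skeleton.

What is proved: the lattice-Maxwell plaquette two-point number along the `e₀` axis of `ℤ⁴`,
`c_n = curvaturePlaquetteCorr (d := 4) _ n` (the covariance of the field strengths of the plaquette
at the origin in the `(1,2)` plane and of its translate by `n e₀`), is one third of the second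
difference along `e₀` of the axis lattice Green function:
`c_n = (1/3) (G((n+1)e₀) + G((n−1)e₀) − 2 G(n e₀))`, `G = latticeGreen`, for `n ≠ 0`.

Proof: expanding `curvatureTwoPoint` into its sixteen `edgeGreen` terms and using evenness of
`latticeGreen` gives `c_n = 2G(z) − ½ (G(z+e₁) + G(z−e₁) + G(z+e₂) + G(z−e₂))`, `z = n e₀`
(`SecondDifference.curvaturePlaquetteCorr_eq_sixteen`); the coordinate swaps `1 ↔ 2`, `1 ↔ 3`
fix `z` and show that the transverse neighbours contribute equally; harmonicity of `latticeGreen`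
off the origin (`latticeLaplacianZd_latticeGreen_of_ne_zero`, `d = 4 ≥ 3`) then trades the
transverse second difference for the axial one. Only proved tree facts are used.
-/

noncomputable section

open Literature.MathematicalPhysics.QuantumFieldTheory Literature.Probability.LatticeModels

namespace Summit.QuantumFields.YangMills.Theorems.EquipartitionPinsProbe

namespace SecondDifference

/-- The sixteen-term expansion of `c_n`: only equal-direction edge pairs contribute, and evenness
of the Green function collects them as `2G(z) − ½ Σ_{transverse neighbours in directions 1, 2}`. -/
theorem curvaturePlaquetteCorr_eq_sixteen (n : ℤ) :
    curvaturePlaquetteCorr (d := 4) (by norm_num) n =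
      (2 * latticeGreen (Pi.single (0 : Fin 4) n : Site 4)
        - latticeGreen ((Pi.single (0 : Fin 4) n : Site 4) + Pi.single 1 1) / 2
        - latticeGreen ((Pi.single (0 : Fin 4) n : Site 4) - Pi.single 1 1) / 2
        - latticeGreen ((Pi.single (0 : Fin 4) n : Site 4) + Pi.single 2 1) / 2
        - latticeGreen ((Pi.single (0 : Fin 4) n : Site 4) - Pi.single 2 1) / 2) := by
  simp only [curvaturePlaquetteCorr, curvatureTwoPoint, Fin.sum_univ_four, plaquetteBoundary,
    plaquetteBoundarySign, edgeGreen, plaquette12, Matrix.cons_val_zero, Matrix.cons_val_one,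
    Matrix.cons_val, Fin.mk.injEq, if_true, show (1 : ℕ) ≠ 2 from by decide,
    show (2 : ℕ) ≠ 1 from by decide, if_false]
  have e0 : (⟨0, by norm_num⟩ : Fin 4) = 0 := rfl
  have e1 : (⟨1, by norm_num⟩ : Fin 4) = 1 := rfl
  have e2 : (⟨2, by norm_num⟩ : Fin 4) = 2 := rfl
  simp only [e0, e1, e2]
  set z : Site 4 := Pi.single (0 : Fin 4) n with hz
  have h1 : (0 : Site 4) - z = -z := zero_sub z
  have h2 : (0 : Site 4) - (z + Pi.single 1 1) = -(z + Pi.single 1 1) := zero_sub _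
  have h3 : (0 : Site 4) - (z + Pi.single 2 1) = -(z + Pi.single 2 1) := zero_sub _
  have h4 : (0 : Site 4) + Pi.single 1 1 - (z + Pi.single 1 1) = -z := by abel
  have h5 : (0 : Site 4) + Pi.single 1 1 - z = -(z - Pi.single 1 1) := by abel
  have h6 : (0 : Site 4) + Pi.single 2 1 - z = -(z - Pi.single 2 1) := by abel
  have h7 : (0 : Site 4) + Pi.single 2 1 - (z + Pi.single 2 1) = -z := by abel
  rw [h1, h2, h3, h4, h5, h6, h7]
  simp only [latticeGreen_neg]
  ring

/-- Transverse symmetry: for `z = n e₀` and transverse directions `i, j ≠ 0`, the Green function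
takes the same value at `z + eᵢ` and `z + eⱼ` (coordinate swap `i ↔ j`, which fixes `z`). -/
theorem latticeGreen_axis_add_single (n s : ℤ) {i j : Fin 4} (hi : i ≠ 0) (hj : j ≠ 0) :
    latticeGreen ((Pi.single (0 : Fin 4) n : Site 4) + Pi.single i s) =
      latticeGreen ((Pi.single (0 : Fin 4) n : Site 4) + Pi.single j s) := by
  have h := latticeGreen_comp_equiv (Equiv.swap i j) ((Pi.single (0 : Fin 4) n : Site 4) + Pi.single i s)
  have hfun : (((Pi.single (0 : Fin 4) n : Site 4) + Pi.single i s) ∘ (Equiv.swap i j)) =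
      (Pi.single (0 : Fin 4) n : Site 4) + Pi.single j s := by
    funext l
    simp only [Function.comp_apply, Pi.add_apply, Pi.single_apply, Equiv.swap_apply_eq_iff,
      Equiv.swap_apply_left]
    have h0 : (Equiv.swap i j) 0 = (0 : Fin 4) := Equiv.swap_apply_of_ne_of_ne hi.symm hj.symm
    rw [h0]
  rw [hfun] at h
  exact h.symm

end SecondDifference

/-- **STUB 3 of line `Sketch`** (crux `stmt-QuantumFields-8760`): the plaquette two-point number
`c_n` of the lattice Maxwell field in `d = 4` is one third of the axial second difference of the
lattice Green function, `c_n = (1/3)(G((n+1)e₀) + G((n−1)e₀) − 2G(ne₀))`, `n ≠ 0` (sixteen-term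
expansion, transverse symmetry, harmonicity off the origin). -/
theorem stub_secondDifference :
    ∀ n : ℤ, n ≠ 0 →
      Literature.MathematicalPhysics.QuantumFieldTheory.curvaturePlaquetteCorr (d := 4) (by norm_num) n =
        (1 / 3 : ℝ) *
          (Literature.Probability.LatticeModels.latticeGreen
              (Pi.single (0 : Fin 4) (n + 1) : Literature.Probability.LatticeModels.Site 4) +
            Literature.Probability.LatticeModels.latticeGreen
              (Pi.single (0 : Fin 4) (n - 1) : Literature.Probability.LatticeModels.Site 4) -
            2 * Literature.Probability.LatticeModels.latticeGreen
              (Pi.single (0 : Fin 4) n : Literature.Probability.LatticeModels.Site 4)) := by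
  intro n hn
  rw [SecondDifference.curvaturePlaquetteCorr_eq_sixteen]
  set z : Site 4 := Pi.single (0 : Fin 4) n with hz
  have hz0 : z ≠ 0 := by
    intro h
    have := congrFun h 0
    simp [hz] at this
    exact hn this
  -- harmonicity off the origin: Σᵢ (G(z+eᵢ) + G(z−eᵢ)) − 8 G(z) = 0
  have hharm := latticeLaplacianZd_latticeGreen_of_ne_zero (d := 4) (by norm_num) hz0
  rw [latticeLaplacianZd, Fin.sum_univ_four] at hharm
  -- transverse symmetry
  have s2p : latticeGreen (z + Pi.single 2 1) = latticeGreen (z + Pi.single 1 1) :=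
    SecondDifference.latticeGreen_axis_add_single n 1 (by decide) (by decide)
  have s3p : latticeGreen (z + Pi.single 3 1) = latticeGreen (z + Pi.single 1 1) :=
    SecondDifference.latticeGreen_axis_add_single n 1 (by decide) (by decide)
  have s2m : latticeGreen (z - Pi.single 2 1) = latticeGreen (z - Pi.single 1 1) := by
    have h := SecondDifference.latticeGreen_axis_add_single n (-1) (i := 2) (j := 1) (by decide) (by decide)
    simpa only [Pi.single_neg, ← sub_eq_add_neg] using h
  have s3m : latticeGreen (z - Pi.single 3 1) = latticeGreen (z - Pi.single 1 1) := by
    have h := SecondDifference.latticeGreen_axis_add_single n (-1) (i := 3) (j := 1) (by decide) (by decide)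
    simpa only [Pi.single_neg, ← sub_eq_add_neg] using h
  -- axial neighbours
  have ap : z + Pi.single 0 1 = Pi.single (0 : Fin 4) (n + 1) := by
    rw [hz, ← Pi.single_add]
  have am : z - Pi.single 0 1 = Pi.single (0 : Fin 4) (n - 1) := by
    rw [hz, ← Pi.single_sub]
  rw [s2p, s3p, s2m, s3m, ap, am] at hharm
  rw [s2p, s2m]
  have h8 : (2 : ℝ) * (4 : ℕ) = 8 := by norm_num
  rw [h8] at hharm
  linarith
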